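import Summits.NavierStokesRegularity.FluidComputer.PalasekTowerRegisterQuiet
import Summits.NavierStokesRegularity.FluidComputer.PalasekTowerStageUniqueness

/-!
# REGISTER v2.3 = QUIET + ANCHOR: the items of record `EpisodeBaseA` / `EpisodeInductionA`

Cell `ns-blowup`; typist `ns-blowup-lean` (g2) for planner `ns-blowup-plan` (g16), RULING K48 (STATUS
l.1359) on refuter g9's K-CHECK K48 (l.1357). LABEL: E–C typing (KERNEL vocabulary + glue). WHAT THIS
IS NOT: not Navier–Stokes evidence — one margin clause, two NAMED open `Prop`s at the registered
parameters, the assembly, comparisons and the closer; nothing is inhabited or asserted.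

## Why an anchor (refuter K48, planner l.1359)

`Schedule.Rigid` (REGISTER v2.1) pins the GAPS between readouts (`Rigid.τ_eq_of_τ_zero_eq`), not the
origin `τ₀`: the uniform translate `S ↦ S^E` (every readout and `T` shifted by `E`, datum / force /
constants unchanged) of a pinned rigid quiet schedule is again pinned rigid quiet, so the `∀ S` of
`EpisodeInductionQ` / `EpisodeInductionR` ranges over the translates of the designed schedule, whose
level-`k` stage is the designed tower READ LATE — and with `E = T − τ_{k+1}` the induction step plus
`hU` continues the tower through its own blow-up time (K48 (B): class MISSTATED mod hU + a persistence
rider). REPAIR (R-anchor, verbatim the refuter's clause, designer cost nil): conjoin to the registered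
margin the level-0 ANCHOR

`∀ t ∈ [0, τ₀), ∀ x, ‖x‖ ≤ radius → ‖u t x‖ < c₁ Y₀`

— `τ₀` is the FIRST time the level-0 floor is met in the ball. A stage of a translate `S^{±E}`, `E ≠ 0`,
built from the same flow then violates the anchor (late) or the floor (early): `Stage.τ_zero_le_of_anchor`,
`Stage.τ_zero_eq_of_anchors` (pointwise, `hU`-free), and with `Rigid` every readout is a functional of
the flow (`Schedule.Rigid.τ_eq_of_τ_zero_eq`). The `∀ S` now ranges over DESIGNS, not re-readings.

## Contents

* `Schedule.Anchor S u`, `Margins.anchor`, `Margins.withAnchor m` (idiom of `Margins.withStrain`: the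
  new clause first), the route margin `Margins.routeA R := withStrain (withAnchor (register R))`;
* `@[conjecture] EpisodeBaseA`, `@[conjecture] EpisodeInductionA` (ν = 1, `TowerRates.wide`, `Λ = 8`,
  `θ = 6/5`, `Pins ∧ Rigid ∧ Quiet`, margin `routeA wide`) — THE ITEMS OF RECORD FOR THE BIRTH;
* `nonempty_realisation_of_episodesA` (verbatim the Q/R assembly), `palasekStep2_of_episodesA`, closer
  `navierStokesBreakdownR3_of_episodesA : K1A → K2A → W14 → (C)` (W14 =
  `tao2011_forced_unconditionalUniqueness_velocity`, Literature, UNPROVED, fed through `.schwartzForce`);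
* comparisons: `Stage.dropAnchor` (an anchored stage is a stage for the Q/R margin),
  `EpisodeBaseA.episodeBaseQ`, `EpisodeInductionA.of_episodeInductionQ` (the anchor is a `[0, τ₀)`
  clause and is inherited along `Stage.Extends`, so the quiet induction implies the anchored one —
  v2.2 is superseded, not refuted, by the anchor; the K48 lever refutes the Q/R INDUCTIONS, which stay
  in the tree as settled negative edges once the refuter's Phase D lands).

References: S. Palasek, arXiv:2605.13827 §3.3, §4 [cite: Palasek2026ElementaryModel, §3–§4];
C. L. Fefferman, Clay problem description, (C) [cite: FeffermanClay2006, (C)]; T. Tao, Anal. PDE 6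
(2013), Cor. 11.4 [cite: Tao2011, Cor. 11.4].
-/

noncomputable section

namespace Summit.NavierStokesRegularity.FluidComputer.PalasekTowerClayBridge

open Set MeasureTheory Filter Topology Function
open scoped ENNReal ContDiff NNReal
open Literature.Analysis.FluidPDE

/-! ## §1 The anchor -/

/-- **The level-0 ANCHOR** of a velocity history `u` in the schedule `S`: before the first readout
`τ₀` no point of the tower's ball reaches the level-0 floor speed `c₁ Y₀` — `τ₀` is the FIRST time the
floor is met (refuter K48 R-anchor; planner l.1359). [cite: Palasek2026ElementaryModel, §3.3] -/
def Schedule.Anchor {R : TowerRates} (S : Schedule R)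
    (u : ℝ → EuclideanSpace ℝ (Fin 3) → EuclideanSpace ℝ (Fin 3)) : Prop :=
  ∀ t ∈ Ico 0 (S.τ 0), ∀ x : EuclideanSpace ℝ (Fin 3), ‖x‖ ≤ S.radius → ‖u t x‖ < S.c₁ * R.Y 0

/-- The anchor as a (level-independent) margin. [folklore] -/
def Margins.anchor (R : TowerRates) : Margins R := fun S _ u => S.Anchor u

/-- **The anchor added to a margin** (idiom of `Margins.withStrain`: the new clause first). [folklore] -/
def Margins.withAnchor {R : TowerRates} (m : Margins R) : Margins R := fun S k u =>
  S.Anchor u ∧ m S k u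

/-- **The route margin of REGISTER v2.3**: strain floors ∧ (anchor ∧ (rigidity ∧ core ledger)). [folklore] -/
def Margins.routeA (R : TowerRates) : Margins R :=
  Margins.withStrain (Margins.withAnchor (Margins.register R))

/-- The anchor is inherited by any velocity that agrees with an anchored one on `[0, τ_k]`, `k ≥ 0`
(in particular along `Stage.Extends`). [folklore] -/
theorem Schedule.Anchor.congr {R : TowerRates} {S : Schedule R} {k : ℕ}
    {u v : ℝ → EuclideanSpace ℝ (Fin 3) → EuclideanSpace ℝ (Fin 3)} (h : S.Anchor u)
    (huv : ∀ t ∈ Icc 0 (S.τ k), v t = u t) : S.Anchor v := by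
  intro t ht x hx
  have ht' : t ∈ Icc 0 (S.τ k) := ⟨ht.1, ht.2.le.trans (S.τ_mono (Nat.zero_le k))⟩
  rw [huv t ht']
  exact h t ht x hx

/-- `withAnchor` keeps a level-antitone margin level-antitone. [folklore] -/
theorem Margins.antitone_withAnchor {R : TowerRates} {m : Margins R} (hm : m.Antitone) :
    (Margins.withAnchor m).Antitone :=
  fun S k k' u hk h => ⟨h.1, hm S k k' u hk h.2⟩

/-- The v2.3 route margin is antitone in the level (so `Stage.restrictOfAntitone` applies). [folklore] -/
theorem Margins.antitone_routeA (R : TowerRates) : (Margins.routeA R).Antitone :=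
  fun _ _ _ _ hk h =>
    ⟨fun j hj => h.1 j (hj.trans hk), h.2.1, Margins.register_mono hk h.2.2⟩

/-! ## §2 Anchored stages: accessors, dropping the anchor, the dead lever (pointwise) -/

namespace Stage

variable {ν : ℝ} {R : TowerRates} {S S' : Schedule R} {k k' : ℕ}

/-- An anchored stage's anchor. [folklore] -/
theorem routeA_anchor (s : Stage ν R S (Margins.routeA R) k) : S.Anchor s.u := s.margin.2.1

/-- … its rigidity. [folklore] -/
theorem routeA_rigid (s : Stage ν R S (Margins.routeA R) k) : S.Rigid := s.margin.2.2.1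

/-- … its core ledger. [folklore] -/
theorem routeA_coreLedger (s : Stage ν R S (Margins.routeA R) k) : CoreLedger R S k s.u :=
  s.margin.2.2.2

/-- … its strain floors. [folklore] -/
theorem routeA_strain (s : Stage ν R S (Margins.routeA R) k) :
    ∀ j, j ≤ k → ∃ x, ‖x‖ ≤ S.radius ∧ S.c₁ * R.A j ≤ ‖fderiv ℝ (s.u (S.τ j)) x‖ :=
  s.margin.1

/-- **Dropping the anchor**: an anchored stage is a stage for the v2.1/v2.2 route margin
`withStrain (register R)` (same flow). [folklore] -/
def dropAnchor (s : Stage ν R S (Margins.routeA R) k) :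
    Stage ν R S (Margins.withStrain (Margins.register R)) k where
  u := s.u
  p := s.p
  classical := s.classical
  initial := s.initial
  energy := s.energy
  floor := s.floor
  ceiling := s.ceiling
  quiet := s.quiet
  margin := ⟨s.margin.1, s.margin.2.2⟩

/-- The dropped stage has the same velocity. [folklore] -/
theorem dropAnchor_u (s : Stage ν R S (Margins.routeA R) k) : s.dropAnchor.u = s.u := rfl

/-- The dropped stage has the same pressure. [folklore] -/
theorem dropAnchor_p (s : Stage ν R S (Margins.routeA R) k) : s.dropAnchor.p = s.p := rfl

/-- **Adding the anchor back**: a stage for `withStrain (register R)` whose velocity is anchored is a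
stage for the v2.3 margin. [folklore] -/
def addAnchor (s : Stage ν R S (Margins.withStrain (Margins.register R)) k) (h : S.Anchor s.u) :
    Stage ν R S (Margins.routeA R) k where
  u := s.u
  p := s.p
  classical := s.classical
  initial := s.initial
  energy := s.energy
  floor := s.floor
  ceiling := s.ceiling
  quiet := s.quiet
  margin := ⟨s.margin.1, h, s.margin.2⟩

/-- **The dead lever, pointwise (no `hU`)**: if an anchored stage of `S` and a stage of `S'` (any margin)
share the velocity at `S'`'s first readout, `S'`'s ball lies in `S`'s and `S'`'s floor constant is at
least `S`'s, then `S'` does not read level `0` EARLIER than `S`: `S.τ 0 ≤ S'.τ 0` (an earlier floor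
would contradict the anchor). For the translates `S^{±E}` of K48 all three side conditions hold with
equality. [folklore] -/
theorem τ_zero_le_of_anchor {m' : Margins R} (s : Stage ν R S (Margins.routeA R) k)
    (s' : Stage ν R S' m' k') (hu : s'.u (S'.τ 0) = s.u (S'.τ 0))
    (hrad : S'.radius ≤ S.radius) (hc : S.c₁ ≤ S'.c₁) : S.τ 0 ≤ S'.τ 0 := by
  by_contra hlt
  have hlt' : S'.τ 0 < S.τ 0 := lt_of_not_ge hlt
  obtain ⟨x, hx, hfl⟩ := s'.floor 0 (Nat.zero_le k')
  have hY : 0 < R.Y 0 := Real.rpow_pos_of_pos (R.N_pos 0) _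
  have hanch := s.routeA_anchor (S'.τ 0) ⟨(S'.τ_pos 0).le, hlt'⟩ x (hx.trans hrad)
  rw [← hu] at hanch
  have : S'.c₁ * R.Y 0 ≤ S.c₁ * R.Y 0 := hfl.trans hanch.le
  have : S'.c₁ ≤ S.c₁ := le_of_mul_le_mul_right this hY
  -- equality of constants forces the strict anchor against the floor
  have hfl' : S.c₁ * R.Y 0 ≤ ‖s'.u (S'.τ 0) x‖ := le_trans (mul_le_mul_of_nonneg_right hc hY.le) hfl
  exact absurd hanch (not_lt.2 hfl')

/-- **The first readout is a functional of the flow**: two anchored stages (of two schedules with the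
same ball and floor constant) sharing their velocity at both first readouts have the same `τ₀`; with
`Schedule.Rigid` on both sides every readout then agrees (`Schedule.Rigid.τ_eq_of_τ_zero_eq`). This
is the kernel form of "the uniform re-timing lever is dead" (K48 REPAIR), stated without `hU`.
[folklore] -/
theorem τ_zero_eq_of_anchors (s : Stage ν R S (Margins.routeA R) k)
    (s' : Stage ν R S' (Margins.routeA R) k') (hu : s'.u (S'.τ 0) = s.u (S'.τ 0))
    (hu' : s.u (S.τ 0) = s'.u (S.τ 0)) (hrad : S'.radius = S.radius) (hc : S.c₁ = S'.c₁) :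
    S.τ 0 = S'.τ 0 :=
  le_antisymm (τ_zero_le_of_anchor s s' hu hrad.le hc.le)
    (τ_zero_le_of_anchor s' s hu' hrad.ge hc.ge)

/-- With rigidity on both sides, equal first readouts give equal readouts at every level. [folklore] -/
theorem τ_eq_of_anchors (s : Stage ν R S (Margins.routeA R) k)
    (s' : Stage ν R S' (Margins.routeA R) k') (hu : s'.u (S'.τ 0) = s.u (S'.τ 0))
    (hu' : s.u (S.τ 0) = s'.u (S.τ 0)) (hrad : S'.radius = S.radius) (hc : S.c₁ = S'.c₁) :
    S.τ = S'.τ :=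
  s.routeA_rigid.τ_eq_of_τ_zero_eq s'.routeA_rigid (τ_zero_eq_of_anchors s s' hu hu' hrad hc)

end Stage

/-! ## §3 The v2.3 items of record (never asserted here) -/

/-- **K1A — the anchored quiet episode base** (open; never asserted): a pinned (`Λ = 8`, `θ = 6/5`),
rigid, quiet schedule on the wide-base rates carries an ANCHORED, strained, cored stage at level `1` at
unit viscosity. [cite: Palasek2026ElementaryModel, §4] -/
@[conjecture] def EpisodeBaseA : Prop :=
  ∃ S : Schedule TowerRates.wide, S.Pins 8 (6 / 5) ∧ S.Rigid ∧ S.Quiet ∧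
    Nonempty (Stage 1 TowerRates.wide S (Margins.routeA TowerRates.wide) 1)

/-- **K2A — the anchored quiet episode induction** (open; the hard piece; never asserted): over
pinned, rigid, quiet schedules on the wide-base rates, every anchored strained cored stage at level
`k ≥ 1` extends to level `k+1` — autonomous heredity of DESIGNS (the anchor removes re-readings).
[cite: Palasek2026ElementaryModel, §4] -/
@[conjecture] def EpisodeInductionA : Prop :=
  ∀ S : Schedule TowerRates.wide, S.Pins 8 (6 / 5) → S.Rigid → S.Quiet → ∀ k : ℕ, 1 ≤ k →
    ∀ s : Stage 1 TowerRates.wide S (Margins.routeA TowerRates.wide) k,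
      ∃ s' : Stage 1 TowerRates.wide S (Margins.routeA TowerRates.wide) (k + 1), s.Extends s'

/-! ## §4 Assembly, comparisons, closer -/

/-- **K1A ∧ K2A ⇒ the interface is inhabited at unit viscosity** (verbatim the Q/R assembly).
[cite: Palasek2026ElementaryModel, §4] -/
theorem nonempty_realisation_of_episodesA (h₁ : EpisodeBaseA) (h₂ : EpisodeInductionA) :
    Nonempty (Realisation 1 TowerRates.wide) := by
  obtain ⟨S, hP, hR, hQ, ⟨s₁⟩⟩ := h₁
  exact ⟨Realisation.ofEpisodes S s₁ (fun n s => h₂ S hP hR hQ (n + 1) (by omega) s)⟩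

/-- The anchored base implies the quiet base (drop the anchor). [folklore] -/
theorem EpisodeBaseA.episodeBaseQ (h : EpisodeBaseA) : EpisodeBaseQ := by
  obtain ⟨S, hP, hR, hQ, ⟨s⟩⟩ := h
  exact ⟨S, hP, hR, hQ, ⟨s.dropAnchor⟩⟩

/-- **The quiet induction implies the anchored one**: drop the anchor, extend by K2Q, and inherit the
anchor along `Extends` (it is a `[0, τ₀)` clause). So REGISTER v2.2 is superseded by v2.3, not refuted
by it. [folklore] -/
theorem EpisodeInductionA.of_episodeInductionQ (h : EpisodeInductionQ) : EpisodeInductionA := by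
  intro S hP hR hQ k hk s
  obtain ⟨s', hs'⟩ := h S hP hR hQ k hk s.dropAnchor
  have hanch : S.Anchor s'.u :=
    (s.routeA_anchor).congr (k := k) (fun t ht => (hs' t ht).1)
  refine ⟨s'.addAnchor hanch, fun t ht => ?_⟩
  exact hs' t ht

/-- … hence also the v2.1 ∀-robust induction implies the anchored one. [folklore] -/
theorem EpisodeInductionA.of_episodeInductionR (h : EpisodeInductionR) : EpisodeInductionA :=
  EpisodeInductionA.of_episodeInductionQ (EpisodeInductionQ.of_episodeInductionR h)

/-- The rigidity hypothesis of K2A is redundant given the stage (the margin carries it). [folklore] -/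
theorem EpisodeInductionA.of_noRigid
    (h : ∀ S : Schedule TowerRates.wide, S.Pins 8 (6 / 5) → S.Quiet → ∀ k : ℕ, 1 ≤ k →
      ∀ s : Stage 1 TowerRates.wide S (Margins.routeA TowerRates.wide) k,
        ∃ s' : Stage 1 TowerRates.wide S (Margins.routeA TowerRates.wide) (k + 1), s.Extends s') :
    EpisodeInductionA :=
  fun S hP _ hQ k hk s => h S hP hQ k hk s

/-- K1A ∧ K2A ⇒ Palasek's Step 2 for the wide-base rates (all viscosities). [cite: Palasek2026ElementaryModel, §4] -/
theorem palasekStep2_of_episodesA (h₁ : EpisodeBaseA) (h₂ : EpisodeInductionA) :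
    PalasekStep2 TowerRates.wide := by
  obtain ⟨W⟩ := nonempty_realisation_of_episodesA h₁ h₂
  exact palasekStep2_of_realisation one_pos W

/-- **CLOSER (v2.3 items of record).** K1A → K2A → W14 → Fefferman's (C); W14 = the Literature named
fact `tao2011_forced_unconditionalUniqueness_velocity` (UNPROVED; hypothesis) fed through
`.schwartzForce` to the landed bridge. Conditional on all three; none is asserted.
[cite: FeffermanClay2006, (C)] [cite: Tao2011, Cor. 11.4] -/
theorem navierStokesBreakdownR3_of_episodesA (h₁ : EpisodeBaseA) (h₂ : EpisodeInductionA)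
    (hU : tao2011_forced_unconditionalUniqueness_velocity) :
    Summit.NavierStokesRegularity.NavierStokesRegularity.NavierStokesBreakdownR3 :=
  navierStokesBreakdownR3_of_step2 TowerRates.wide
    (tao2011_forced_unconditionalUniqueness_velocity.schwartzForce hU)
    (palasekStep2_of_episodesA h₁ h₂)

end Summit.NavierStokesRegularity.FluidComputer.PalasekTowerClayBridge

end
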